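import Literature.RingTheory.MvPolynomial.WeightOperators
import Mathlib.RingTheory.Derivation.Basic
import Mathlib.LinearAlgebra.Span.Basic

/-!
# `𝔤𝔩_n` acting on `R[V ⊕ V^*]`: polarisation operators, the invariant pairing, balanced support

Topic `Literature/RepresentationTheory/ClassicalInvariants`.  Let `V = R^n` with coordinates
`z_1, …, z_n` and let `w_1, …, w_n` be the dual coordinates on `V^*`.  The Lie algebra `𝔤𝔩_n` acts on
the polynomial ring `R[z, w] = R[V ⊕ V^*]` (standard representation on `V`, contragredient on `V^*`)
by the **polarisation operators**

`E_{ab} = z_a ∂/∂z_b − w_b ∂/∂w_a`   (`polarization a b`, an `R`-derivation),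

whose diagonal members `E_{aa} = z_a ∂_{z_a} − w_a ∂_{w_a}` are the weight operators of the diagonal
torus (`polarization_self : E_{aa} = weightOp (torusWt a)`).  This file sets up the model and proves
the elementary half of the first fundamental theorem for `GL(V)` on `V ⊕ V^*` in infinitesimal form
(completed in `VectorCovectorFFT`):

* the canonical pairing `P = Σ_a z_a w_a` (`pairing`) and all its powers are killed by every `E_{ab}`
  (`polarization_pairing`, `isGLnInvariant_pairing_pow`, `isGLnInvariant_of_mem_span`); the
  invariants `glnInvariants R n` form a submodule;
* torus invariance = the support consists of BALANCED monomials `z^γ w^γ` (`balanced_of_torus`);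
* `E_{ab} f = 0` forces the recursion `(γ_b + 1)·c(γ + e_b) = (γ_a + 1)·c(γ + e_a)` on the balanced
  coefficients `c(γ) = coeff_{z^γ w^γ} f` (`coeff_bal_recursion`), so that an invariant whose
  pure-power coefficients `c(k e_0)` vanish is zero (`coeff_bal_eq_zero`, `eq_zero_of_isGLnInvariant`)
  — over an integral domain of characteristic zero.

Sources: R. Goodman, N. R. Wallach, *Symmetry, Representations, and Invariants* (GTM 255) §5.2.1,
Thm 5.2.1 (polynomial FFT for `GL(V)`); R. Howe, *Remarks on classical invariant theory*, Trans. AMS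
313 (1989) §1 (Thm 1A "This is in Weyl", Thm 2: invariants generated in degree 2); H. Weyl, *The
Classical Groups*, Ch. II.  The coefficient-recursion argument is the one given for `n = 3` in the
`pub-hodgecm` cell package (`HodgeCM/PerL34/ArchB.lean` §M, "mixed-signature Fock model"), here for
general `n`; all statements in this file are folklore.

## Mathlib / tree

Mathlib has no classical invariant theory beyond determinant identities; the tree's
`Literature.RepresentationTheory.AlgebraicGroups.FirstFundamentalTheoremSL*` treat the GROUP `SL_N`
acting on `M` vectors (bracket invariants, Sturmfels 1993 §3.2), not vectors-and-covectors and not the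
Lie algebra.  Weight operators: `Literature.RingTheory.MvPolynomial.WeightOperators`.
-/

namespace Literature.RepresentationTheory.ClassicalInvariants

open _root_.MvPolynomial Finsupp
open Literature.RingTheory.MvPolynomial
open scoped BigOperators

noncomputable section

/-! ### The model `R[z_1..z_n, w_1..w_n]` and the polarisation operators -/

/-- Variables of `R[V ⊕ V^*]`, `V = R^n`: `inl a` is the vector coordinate `z_a`, `inr a` the covector
coordinate `w_a`. [folklore] -/
abbrev VCVar (n : ℕ) : Type := Fin n ⊕ Fin n

variable {R : Type*} [CommRing R] {n : ℕ}

variable (R n) in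
/-- The canonical pairing `P = Σ_a z_a w_a ∈ R[V ⊕ V^*]` (the basic `GL(V)`-invariant). [folklore] -/
def pairing : MvPolynomial (VCVar n) R := ∑ a : Fin n, X (Sum.inl a) * X (Sum.inr a)

/-- Weights of the diagonal torus `diag(t_1,…,t_n) ⊂ GL_n` on `R[V ⊕ V^*]`: `z_a` has weight `e_a`,
`w_a` weight `−e_a`; `torusWt a` is the `a`-th coordinate of the weight. [folklore] -/
def torusWt (a : Fin n) : VCVar n → ℤ
  | Sum.inl a' => if a' = a then 1 else 0
  | Sum.inr a' => if a' = a then -1 else 0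

/-- The polarisation operator `E_{ab} = z_a ∂/∂z_b − w_b ∂/∂w_a`: the action of the elementary matrix
`e_{ab} ∈ 𝔤𝔩_n` on `R[V ⊕ V^*]` (standard on `V`, contragredient on `V^*`), as an `R`-derivation.
[folklore] -/
def polarization (a b : Fin n) :
    Derivation R (MvPolynomial (VCVar n) R) (MvPolynomial (VCVar n) R) :=
  (X (Sum.inl a) : MvPolynomial (VCVar n) R) • pderiv (Sum.inl b) -
    (X (Sum.inr b) : MvPolynomial (VCVar n) R) • pderiv (Sum.inr a)

/-- [folklore] -/
theorem polarization_apply (a b : Fin n) (f : MvPolynomial (VCVar n) R) :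
    polarization a b f = X (Sum.inl a) * pderiv (Sum.inl b) f - X (Sum.inr b) * pderiv (Sum.inr a) f := by
  simp [polarization, Derivation.sub_apply, smul_eq_mul]

/-- The weight of a monomial `z^α w^β` for the `a`-th torus coordinate is `α_a − β_a`. [folklore] -/
theorem wt_torusWt (a : Fin n) (m : VCVar n →₀ ℕ) :
    wt (torusWt a) m = (m (Sum.inl a) : ℤ) - m (Sum.inr a) := by
  classical
  rw [wt, Fintype.sum_sum_type, Finset.sum_eq_single a, Finset.sum_eq_single a]
  · simp [torusWt]; ring
  · intro b _ hb; simp [torusWt, hb]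
  · intro h; exact absurd (Finset.mem_univ a) h
  · intro b _ hb; simp [torusWt, hb]
  · intro h; exact absurd (Finset.mem_univ a) h

/-- The diagonal polarisation `E_{aa} = z_a ∂_{z_a} − w_a ∂_{w_a}` is the weight operator of the `a`-th
torus coordinate. [folklore] -/
theorem polarization_self (a : Fin n) (f : MvPolynomial (VCVar n) R) :
    polarization a a f = weightOp (torusWt a) f := by
  classical
  rw [polarization_apply, weightOp_apply, Fintype.sum_sum_type, Finset.sum_eq_single a,
    Finset.sum_eq_single a]
  · simp [torusWt, sub_eq_add_neg]
  · intro b _ hb; simp [torusWt, hb]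
  · intro h; exact absurd (Finset.mem_univ a) h
  · intro b _ hb; simp [torusWt, hb]
  · intro h; exact absurd (Finset.mem_univ a) h

/-- `𝔤𝔩_n`-invariance of `f ∈ R[V ⊕ V^*]`: `f` is annihilated by every polarisation `E_{ab}`.
[folklore] -/
def IsGLnInvariant (f : MvPolynomial (VCVar n) R) : Prop := ∀ a b : Fin n, polarization a b f = 0

/-- Split form: torus weights zero and off-diagonal polarisations zero. [folklore] -/
theorem isGLnInvariant_iff_torus_and_offDiag (f : MvPolynomial (VCVar n) R) :
    IsGLnInvariant f ↔
      (∀ a, weightOp (torusWt a) f = 0) ∧ ∀ a b, a ≠ b → polarization a b f = 0 := by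
  constructor
  · intro h
    exact ⟨fun a => by rw [← polarization_self]; exact h a a, fun a b _ => h a b⟩
  · rintro ⟨ht, ho⟩ a b
    by_cases hab : a = b
    · subst hab; rw [polarization_self]; exact ht a
    · exact ho a b hab

/-- The invariants form an `R`-submodule (indeed a subalgebra, the polarisations being derivations).
[folklore] -/
def glnInvariants (R : Type*) [CommRing R] (n : ℕ) : Submodule R (MvPolynomial (VCVar n) R) where
  carrier := {f | IsGLnInvariant f}
  add_mem' hf hg a b := by rw [map_add, hf a b, hg a b, add_zero]
  zero_mem' a b := map_zero _
  smul_mem' c f hf a b := by rw [Derivation.map_smul, hf a b, smul_zero]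

/-- [folklore] -/
theorem mem_glnInvariants_iff (f : MvPolynomial (VCVar n) R) : f ∈ glnInvariants R n ↔ IsGLnInvariant f :=
  Iff.rfl

/-! ### `P` and its powers are invariant -/

/-- `E_{ab} P = z_a w_b − w_b z_a = 0`. [folklore] -/
theorem polarization_pairing (a b : Fin n) : polarization a b (pairing R n) = 0 := by
  classical
  rw [polarization_apply, pairing, map_sum, map_sum]
  have h1 : ∑ c : Fin n, pderiv (Sum.inl b) (X (Sum.inl c) * X (Sum.inr c) : MvPolynomial (VCVar n) R)
      = X (Sum.inr b) := by
    rw [Finset.sum_eq_single b]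
    · rw [Derivation.leibniz, pderiv_X, pderiv_X, Pi.single_eq_same]
      simp
    · intro c _ hc
      rw [Derivation.leibniz, pderiv_X, pderiv_X, Pi.single_eq_of_ne (Sum.inl_injective.ne hc),
        Pi.single_eq_of_ne Sum.inr_ne_inl]
      simp
    · intro h; exact absurd (Finset.mem_univ b) h
  have h2 : ∑ c : Fin n, pderiv (Sum.inr a) (X (Sum.inl c) * X (Sum.inr c) : MvPolynomial (VCVar n) R)
      = X (Sum.inl a) := by
    rw [Finset.sum_eq_single a]
    · rw [Derivation.leibniz, pderiv_X, pderiv_X, Pi.single_eq_same]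
      simp
    · intro c _ hc
      rw [Derivation.leibniz, pderiv_X, pderiv_X, Pi.single_eq_of_ne Sum.inl_ne_inr,
        Pi.single_eq_of_ne (Sum.inr_injective.ne hc)]
      simp
    · intro h; exact absurd (Finset.mem_univ a) h
  rw [h1, h2]; ring

/-- Every power of the pairing is `𝔤𝔩_n`-invariant. [folklore] -/
theorem isGLnInvariant_pairing_pow (k : ℕ) : IsGLnInvariant (pairing R n ^ k) := fun a b => by
  rw [Derivation.leibniz_pow, polarization_pairing, smul_zero, smul_zero]

/-- Every polynomial in `P` is `𝔤𝔩_n`-invariant. [folklore] -/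
theorem isGLnInvariant_of_mem_span {f : MvPolynomial (VCVar n) R}
    (hf : f ∈ Submodule.span R (Set.range fun k : ℕ => pairing R n ^ k)) : IsGLnInvariant f := by
  rw [← mem_glnInvariants_iff]
  refine (Submodule.span_le.mpr ?_) hf
  rintro _ ⟨k, rfl⟩
  exact isGLnInvariant_pairing_pow k

/-! ### Balanced monomials and the coefficient recursion -/

/-- The balanced exponent `z^γ w^γ`. [folklore] -/
def bal (γ : Fin n →₀ ℕ) : VCVar n →₀ ℕ := sumElim γ γ

/-- The `z`-half of an exponent. [folklore] -/
def half (m : VCVar n →₀ ℕ) : Fin n →₀ ℕ := equivFunOnFinite.symm fun a => m (Sum.inl a)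

/-- A balanced exponent is `bal` of its `z`-half. [folklore] -/
theorem bal_half {m : VCVar n →₀ ℕ} (h : ∀ a, m (Sum.inl a) = m (Sum.inr a)) : bal (half m) = m := by
  ext v
  rcases v with a | a
  · simp [bal, half, sumElim_inl]
  · simp [bal, half, sumElim_inr, h a]

/-- [folklore] -/
theorem bal_single (a : Fin n) (k : ℕ) :
    bal (single a k) = single (Sum.inl a) k + single (Sum.inr a) k := by
  classical
  ext v; rcases v with a' | a' <;> simp [bal, single_apply, eq_comm]

/-- `Finsupp.sumElim` is additive in both arguments. [folklore] -/
private theorem sumElim_add (f f' g g' : Fin n →₀ ℕ) :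
    (sumElim (f + f') (g + g') : VCVar n →₀ ℕ) = sumElim f g + sumElim f' g' := by
  ext v; rcases v with a | a <;> simp

/-- `sumElim (single a k) 0 = single (inl a) k`. [folklore] -/
private theorem sumElim_single_zero (a : Fin n) (k : ℕ) :
    (sumElim (single a k) 0 : VCVar n →₀ ℕ) = single (Sum.inl a) k := by
  classical
  ext v; rcases v with a' | a' <;> simp [single_apply]

/-- `sumElim 0 (single a k) = single (inr a) k`. [folklore] -/
private theorem sumElim_zero_single (a : Fin n) (k : ℕ) :
    (sumElim 0 (single a k) : VCVar n →₀ ℕ) = single (Sum.inr a) k := by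
  classical
  ext v; rcases v with a' | a' <;> simp [single_apply]

section Domain

variable [IsDomain R] [CharZero R]

/-- Torus invariance means balanced support: every monomial `z^α w^β` of `f` has `α = β`.
[folklore] -/
theorem balanced_of_torus {f : MvPolynomial (VCVar n) R} (h : ∀ a, weightOp (torusWt a) f = 0)
    {m : VCVar n →₀ ℕ} (hm : m ∈ f.support) (a : Fin n) : m (Sum.inl a) = m (Sum.inr a) := by
  have := wt_eq_zero_of_weightOp_eq_zero (h a) hm
  rw [wt_torusWt] at this
  omega

omit [IsDomain R] [CharZero R] in
/-- The coefficient recursion forced by `E_{ab} f = 0`: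
`(δ_b + 1)·c(δ + e_b) = (δ_a + 1)·c(δ + e_a)` for the balanced coefficients `c(γ) = coeff_{z^γ w^γ} f`.
[folklore] -/
theorem coeff_bal_recursion {f : MvPolynomial (VCVar n) R} (a b : Fin n) (hE : polarization a b f = 0)
    (δ : Fin n →₀ ℕ) :
    ((δ b : R) + 1) * coeff (bal (δ + single b 1)) f
      = ((δ a : R) + 1) * coeff (bal (δ + single a 1)) f := by
  classical
  set ν : VCVar n →₀ ℕ := sumElim (δ + single a 1) (δ + single b 1) with hν
  have h := congrArg (coeff ν) hE
  rw [polarization_apply, coeff_sub, coeff_zero] at h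
  have h1 : coeff ν (X (Sum.inl a) * pderiv (Sum.inl b) f)
      = ((δ b : R) + 1) * coeff (bal (δ + single b 1)) f := by
    have e1 : ν = single (Sum.inl a) 1 + sumElim δ (δ + single b 1) := by
      rw [hν, ← zero_add (δ + single b 1), show δ + single a 1 = single a 1 + δ from add_comm _ _,
        sumElim_add, sumElim_single_zero, zero_add]
    have e2 : (sumElim δ (δ + single b 1) : VCVar n →₀ ℕ) + single (Sum.inl b) 1
        = bal (δ + single b 1) := by
      rw [bal, ← sumElim_single_zero, ← sumElim_add, add_zero]
    rw [e1, coeff_X_mul, coeff_pderiv, e2, sumElim_inl]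
    ring
  have h2 : coeff ν (X (Sum.inr b) * pderiv (Sum.inr a) f)
      = ((δ a : R) + 1) * coeff (bal (δ + single a 1)) f := by
    have e1 : ν = single (Sum.inr b) 1 + sumElim (δ + single a 1) δ := by
      rw [hν, show δ + single b 1 = single b 1 + δ from add_comm _ _, ← zero_add (δ + single a 1),
        sumElim_add, sumElim_zero_single, zero_add]
    have e2 : (sumElim (δ + single a 1) δ : VCVar n →₀ ℕ) + single (Sum.inr a) 1
        = bal (δ + single a 1) := by
      rw [bal, ← sumElim_zero_single, ← sumElim_add, add_zero]
    rw [e1, coeff_X_mul, coeff_pderiv, e2, sumElim_inr]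
    ring
  rw [h1, h2] at h
  exact sub_eq_zero.mp h

variable [NeZero n]

/-- Propagation: if `E_{0b} f = 0` for all `b ≠ 0` and the coefficients of `f` on the pure powers
`(z_0 w_0)^k` vanish, then ALL balanced coefficients of `f` vanish. [folklore] -/
theorem coeff_bal_eq_zero {f : MvPolynomial (VCVar n) R} (hE : ∀ b, b ≠ 0 → polarization 0 b f = 0)
    (h0 : ∀ k : ℕ, coeff (bal (single 0 k)) f = 0) (γ : Fin n →₀ ℕ) : coeff (bal γ) f = 0 := by
  classical
  -- induction on the total exponent away from the index `0`
  suffices H : ∀ k : ℕ, ∀ γ : Fin n →₀ ℕ,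
      (∑ b ∈ Finset.univ.erase 0, γ b) = k → coeff (bal γ) f = 0 from H _ γ rfl
  intro k
  induction k using Nat.strong_induction_on with
  | _ k ih =>
    intro γ hk
    by_cases hex : ∃ b, b ≠ 0 ∧ 1 ≤ γ b
    · obtain ⟨b, hb, hγb⟩ := hex
      obtain ⟨δ, rfl⟩ : ∃ δ, γ = δ + single b 1 :=
        ⟨γ - single b 1, (tsub_add_cancel_of_le (single_le_iff.mpr (by simpa using hγb))).symm⟩
      have hrec := coeff_bal_recursion 0 b (hE b hb) δ
      have hlt :
          (∑ c ∈ Finset.univ.erase (0 : Fin n), (δ + single (0 : Fin n) 1 : Fin n →₀ ℕ) c) < k := by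
        rw [← hk]
        have e1 : ∑ c ∈ Finset.univ.erase (0 : Fin n), (δ + single (0 : Fin n) 1 : Fin n →₀ ℕ) c
            = ∑ c ∈ Finset.univ.erase (0 : Fin n), δ c :=
          Finset.sum_congr rfl fun c hc => by
            rw [Finsupp.add_apply, single_eq_of_ne (Finset.ne_of_mem_erase hc), add_zero]
        have e2 : ∑ c ∈ Finset.univ.erase (0 : Fin n), (δ + single b 1 : Fin n →₀ ℕ) c
            = (∑ c ∈ Finset.univ.erase (0 : Fin n), δ c) + 1 := by
          have e3 : ∑ c ∈ Finset.univ.erase (0 : Fin n), (single b 1 : Fin n →₀ ℕ) c = 1 := by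
            rw [Finset.sum_eq_single_of_mem b (Finset.mem_erase.mpr ⟨hb, Finset.mem_univ b⟩)
              (fun c _ hc => single_eq_of_ne hc), single_eq_same]
          rw [Finset.sum_congr rfl fun c _ => Finsupp.add_apply δ (single b 1) c,
            Finset.sum_add_distrib, e3]
        rw [e1, e2]; exact Nat.lt_succ_self _
      have hδ : coeff (bal (δ + single 0 1)) f = 0 := ih _ hlt _ rfl
      rw [hδ, mul_zero] at hrec
      exact (mul_eq_zero.mp hrec).resolve_left (by exact_mod_cast Nat.succ_ne_zero (δ b))
    · push Not at hex
      have hγ : γ = single 0 (γ 0) := by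
        ext c
        by_cases hc : c = 0
        · subst hc; rw [single_eq_same]
        · rw [single_eq_of_ne hc]
          have := hex c hc
          omega
      rw [hγ]; exact h0 _

/-- Uniqueness: a `𝔤𝔩_n`-invariant whose pure-power coefficients `coeff_{(z_0 w_0)^k}` all vanish is
zero. [folklore] -/
theorem eq_zero_of_isGLnInvariant {f : MvPolynomial (VCVar n) R} (hf : IsGLnInvariant f)
    (h0 : ∀ k : ℕ, coeff (bal (single 0 k)) f = 0) : f = 0 := by
  ext m
  rw [coeff_zero]
  by_contra hne
  have hm : m ∈ f.support := MvPolynomial.mem_support_iff.mpr hne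
  have ht := ((isGLnInvariant_iff_torus_and_offDiag f).mp hf).1
  have hbal := bal_half (balanced_of_torus ht hm)
  have := coeff_bal_eq_zero (fun b _ => hf 0 b) h0 (half m)
  rw [hbal] at this
  exact hne this

end Domain

end

end Literature.RepresentationTheory.ClassicalInvariants
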